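import Mathlib
import Summits.ValiantsHypothesis.ValiantsHypothesis.Theorems.DivisionGapTriangularDimersDivisionEasyDefs

/-!
# Crux `DivisionGap.TriangularDimersDivisionEasy` (stmt-ValiantsHypothesis-5067), line `diagonal-spider-shuffling` —
helper file 1 of the registered stub `stub_rhombusExtraction` (RHOMBUS EXTRACTION)

Combinatorial core of the extraction of the rhombus dimer polynomial `D_n` from the generic matching
polynomial `pm E` of a member `E` (on `Fin k`) of a cofinal supergraph family: `R_n` embeds by
`ι : Fin n × Fin n ↪ Fin k` edges-to-edges, and the complement of `range ι` has a perfect matching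
`g` inside `E`.

Relabel the oriented variable `x_(u, u')` of `pm E` by `lab (u, u')`:
* `Sum.inl (v, w)` (ε-weight `0`) if `(u, u') = (ι v, ι w)` with `v, w` adjacent in `R_n`;
* `Sum.inr true` (ε-weight `1`) if `u ∉ range ι` and `u' = g u`;
* `Sum.inr false` (ε-weight `2`) otherwise.
Then every term of `rename lab (pm E)` (one per fixed-point-free involution `f` along `E`) is a
monomial of ε-weight `≥ K := #(range ι)ᶜ`, with equality iff `f` is `ι ∘ d ∘ ι⁻¹` on `range ι` for a
dimer cover `d` of `R_n` and `g` off `range ι` (`exists_dimer_of_weight_eq`); hence the KEY LEMMA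
`Extraction.rhombusExtraction_key`: the weighted homogeneous component of ε-weight `K` of
`rename lab (pm E)` is `X (Sum.inr true) ^ K * rename Sum.inl D_n` — the rhombus polynomial, up to a
monomial factor that the specialisation `ε ↦ 1` removes.

No `def` is declared: the weight `wt`, the labelling `lab` and the extension map `ext` are passed as
hypotheses (`hwt`, `hlab`, `hext`); `exists_lab`, `exists_ext` construct them. [folklore]
-/

-- `Summit.ValiantsHypothesis.ValiantsHypothesis.…` is the tree's mandated single-conjunct layout (Sub = Summit).
set_option linter.dupNamespace false

namespace Summit.ValiantsHypothesis.ValiantsHypothesis.Theorems.TriangularDimersDivisionEasy.Shuffling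

open scoped BigOperators NNReal
open Finset MvPolynomial

noncomputable section

namespace Extraction
/-! ### Helper lemmas for `stub_rhombusExtraction` (this stub's private namespace), part 1 -/

/-! #### The two constructions -/

/-- EXTENSION of a self-map `d` of the rhombus to `Fin k`: `ι ∘ d ∘ ι⁻¹` on `range ι`, the outer
matching `g` elsewhere. [folklore] -/
theorem exists_ext {n k : ℕ} (ι : Fin n × Fin n ↪ Fin k) (g : Fin k → Fin k) :
    ∃ ext : (Fin n × Fin n → Fin n × Fin n) → Fin k → Fin k,
      (∀ d v, ext d (ι v) = ι (d v)) ∧ (∀ d u, u ∉ Set.range ι → ext d u = g u) :=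
  ⟨fun d => Function.extend ι (ι ∘ d) g, fun _ v => ι.injective.extend_apply _ _ v,
    fun _ _ hu => Function.extend_apply' _ _ _ hu⟩

/-- LABELLING of the oriented pairs of `Fin k`: rhombus edges get their own name, the outer matching
`g` gets `ε₁ = Sum.inr true`, everything else `ε₂ = Sum.inr false`. [folklore] -/
theorem exists_lab {n k : ℕ} (ι : Fin n × Fin n ↪ Fin k) (g : Fin k → Fin k) :
    ∃ lab : Fin k × Fin k → (Fin n × Fin n) × (Fin n × Fin n) ⊕ Bool,
      (∀ v w, AdjR v w → lab (ι v, ι w) = Sum.inl (v, w)) ∧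
      (∀ p vw, lab p = Sum.inl vw → p = (ι vw.1, ι vw.2) ∧ AdjR vw.1 vw.2) ∧
      (∀ u, u ∉ Set.range ι → lab (u, g u) = Sum.inr true) ∧
      (∀ u u', u ∉ Set.range ι → lab (u, u') = Sum.inr true → u' = g u) := by
  classical
  refine ⟨fun p =>
    if h : ∃ vw : (Fin n × Fin n) × (Fin n × Fin n), (ι vw.1, ι vw.2) = p ∧ AdjR vw.1 vw.2 then
      Sum.inl h.choose
    else if p.1 ∉ Set.range ι ∧ p.2 = g p.1 then Sum.inr true else Sum.inr false,
    fun v w hvw => ?_, fun p vw hp => ?_, fun u hu => ?_, fun u u' hu h => ?_⟩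
  · have h : ∃ vw : (Fin n × Fin n) × (Fin n × Fin n), (ι vw.1, ι vw.2) = (ι v, ι w) ∧
        AdjR vw.1 vw.2 := ⟨(v, w), rfl, hvw⟩
    dsimp only
    rw [dif_pos h, Sum.inl.injEq]
    have h1 := h.choose_spec.1
    rw [Prod.mk.injEq] at h1
    exact Prod.ext (ι.injective h1.1) (ι.injective h1.2)
  · dsimp only at hp
    split_ifs at hp with h₁
    · obtain ⟨hc1, hc2⟩ := h₁.choose_spec
      have e := Sum.inl_injective hp
      subst e
      exact ⟨hc1.symm, hc2⟩
  · have h₁ : ¬∃ vw : (Fin n × Fin n) × (Fin n × Fin n), (ι vw.1, ι vw.2) = (u, g u) ∧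
        AdjR vw.1 vw.2 := by
      rintro ⟨vw, h1, -⟩
      rw [Prod.mk.injEq] at h1
      exact hu ⟨vw.1, h1.1⟩
    dsimp only
    rw [dif_neg h₁, if_pos ⟨hu, rfl⟩]
  · have h₁ : ¬∃ vw : (Fin n × Fin n) × (Fin n × Fin n), (ι vw.1, ι vw.2) = (u, u') ∧
        AdjR vw.1 vw.2 := by
      rintro ⟨vw, h1, -⟩
      rw [Prod.mk.injEq] at h1
      exact hu ⟨vw.1, h1.1⟩
    dsimp only at h
    rw [dif_neg h₁] at h
    by_cases h₂ : u ∉ Set.range ι ∧ u' = g u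
    · exact h₂.2
    · rw [if_neg h₂] at h
      cases h

section Core

variable {n k : ℕ} {ι : Fin n × Fin n ↪ Fin k} {E : Fin k → Fin k → Bool} {g : Fin k → Fin k}
  {wt : (Fin n × Fin n) × (Fin n × Fin n) ⊕ Bool → ℕ}
  {lab : Fin k × Fin k → (Fin n × Fin n) × (Fin n × Fin n) ⊕ Bool}
  {ext : (Fin n × Fin n → Fin n × Fin n) → Fin k → Fin k}

/-! #### The ε-weight -/

/-- Both ε-labels have positive weight. [folklore] -/
theorem one_le_wt_inr (hwt : wt = Sum.elim (fun _ => 0) fun b => cond b 1 2) (b : Bool) :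
    1 ≤ wt (Sum.inr b) := by
  subst hwt; cases b <;> simp

/-- Weight `0` means a rhombus label. [folklore] -/
theorem wt_eq_zero (hwt : wt = Sum.elim (fun _ => 0) fun b => cond b 1 2)
    (x : (Fin n × Fin n) × (Fin n × Fin n) ⊕ Bool) (hx : wt x = 0) : ∃ vw, x = Sum.inl vw := by
  subst hwt
  rcases x with vw | b
  · exact ⟨vw, rfl⟩
  · cases b <;> simp at hx

/-- Weight `1` means the label `ε₁` of the outer matching. [folklore] -/
theorem wt_eq_one (hwt : wt = Sum.elim (fun _ => 0) fun b => cond b 1 2)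
    (x : (Fin n × Fin n) × (Fin n × Fin n) ⊕ Bool) (hx : wt x = 1) : x = Sum.inr true := by
  subst hwt
  rcases x with vw | b
  · simp at hx
  · cases b
    · simp at hx
    · rfl

/-- The complement of the finset `univ.map ι` is the complement of `range ι`. [folklore] -/
theorem mem_compl_map {u : Fin k} : u ∈ (univ.map ι)ᶜ ↔ u ∉ Set.range ι := by
  simp only [Finset.mem_compl, Finset.mem_map, Finset.mem_univ, true_and, Set.mem_range]

/-! #### The relabelled matching polynomial and its terms -/

/-- `rename lab (pm E) = Σ_f Π_u X (lab (u, f u))` over the fixed-point-free involutions `f` along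
`E`. [folklore] -/
theorem rename_pm :
    rename lab (pm E) =
      ∑ f ∈ univ.filter (fun f : Fin k → Fin k => ∀ v, f (f v) = v ∧ f v ≠ v ∧ E v (f v) = true),
        ∏ u, X (lab (u, f u)) := by
  unfold pm
  rw [map_sum]
  exact Finset.sum_congr rfl fun f _ => by rw [map_prod]; simp only [rename_X]

/-- Each term is a product of variables, weighted homogeneous of weight `Σ_u wt (lab (u, f u))`.
[folklore] -/
theorem isWeightedHomogeneous_term (f : Fin k → Fin k) :
    IsWeightedHomogeneous wt
      (∏ u, (X (lab (u, f u)) : MvPolynomial ((Fin n × Fin n) × (Fin n × Fin n) ⊕ Bool) ℝ≥0))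
      (∑ u, wt (lab (u, f u))) :=
  IsWeightedHomogeneous.prod univ _ _ fun _ _ => isWeightedHomogeneous_X ℝ≥0 wt _

/-- The weighted homogeneous component of weight `K` of `rename lab (pm E)` is the sum of its terms of
weight exactly `K`. [folklore] -/
theorem whc_rename_pm (K : ℕ) :
    weightedHomogeneousComponent wt K (rename lab (pm E)) =
      ∑ f ∈ (univ.filter
          (fun f : Fin k → Fin k => ∀ v, f (f v) = v ∧ f v ≠ v ∧ E v (f v) = true)).filter
          (fun f => ∑ u, wt (lab (u, f u)) = K),
        ∏ u, X (lab (u, f u)) := by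
  rw [rename_pm, map_sum]
  conv_rhs => rw [Finset.sum_filter]
  refine Finset.sum_congr rfl fun f _ => ?_
  rw [weightedHomogeneousComponent_of_mem (isWeightedHomogeneous_term f)]
  by_cases h : ∑ u, wt (lab (u, f u)) = K
  · rw [if_pos h, if_pos h.symm]
  · rw [if_neg h, if_neg (Ne.symm h)]

/-! #### Weights are at least `K = #(range ι)ᶜ` -/

/-- Off `range ι` every label is an ε-label, of weight `≥ 1`. [folklore] -/
theorem one_le_wt_lab (hwt : wt = Sum.elim (fun _ => 0) fun b => cond b 1 2)
    (hlab : (∀ v w, AdjR v w → lab (ι v, ι w) = Sum.inl (v, w)) ∧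
      (∀ p vw, lab p = Sum.inl vw → p = (ι vw.1, ι vw.2) ∧ AdjR vw.1 vw.2) ∧
      (∀ u, u ∉ Set.range ι → lab (u, g u) = Sum.inr true) ∧
      (∀ u u', u ∉ Set.range ι → lab (u, u') = Sum.inr true → u' = g u))
    (u u' : Fin k) (hu : u ∈ (univ.map ι)ᶜ) : 1 ≤ wt (lab (u, u')) := by
  rcases hx : lab (u, u') with vw | b
  · have h := (hlab.2.1 _ _ hx).1
    rw [Prod.mk.injEq] at h
    rw [mem_compl_map] at hu
    exact absurd ⟨vw.1, h.1.symm⟩ hu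
  · exact one_le_wt_inr hwt b

/-- Every term has weight at least `K`. [folklore] -/
theorem card_le_weight (hwt : wt = Sum.elim (fun _ => 0) fun b => cond b 1 2)
    (hlab : (∀ v w, AdjR v w → lab (ι v, ι w) = Sum.inl (v, w)) ∧
      (∀ p vw, lab p = Sum.inl vw → p = (ι vw.1, ι vw.2) ∧ AdjR vw.1 vw.2) ∧
      (∀ u, u ∉ Set.range ι → lab (u, g u) = Sum.inr true) ∧
      (∀ u u', u ∉ Set.range ι → lab (u, u') = Sum.inr true → u' = g u))
    (f : Fin k → Fin k) : #(univ.map ι)ᶜ ≤ ∑ u, wt (lab (u, f u)) :=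
  calc #(univ.map ι)ᶜ = ∑ _u ∈ (univ.map ι)ᶜ, 1 := by rw [sum_const, smul_eq_mul, mul_one]
    _ ≤ ∑ u ∈ (univ.map ι)ᶜ, wt (lab (u, f u)) :=
        sum_le_sum fun u hu => one_le_wt_lab hwt hlab u (f u) hu
    _ ≤ ∑ u, wt (lab (u, f u)) := sum_le_univ_sum_of_nonneg fun _ => Nat.zero_le _

/-- Hence every monomial of `rename lab (pm E)` has weight at least `K`. [folklore] -/
theorem le_weight_of_mem_support (hwt : wt = Sum.elim (fun _ => 0) fun b => cond b 1 2)
    (hlab : (∀ v w, AdjR v w → lab (ι v, ι w) = Sum.inl (v, w)) ∧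
      (∀ p vw, lab p = Sum.inl vw → p = (ι vw.1, ι vw.2) ∧ AdjR vw.1 vw.2) ∧
      (∀ u, u ∉ Set.range ι → lab (u, g u) = Sum.inr true) ∧
      (∀ u u', u ∉ Set.range ι → lab (u, u') = Sum.inr true → u' = g u))
    {m : (Fin n × Fin n) × (Fin n × Fin n) ⊕ Bool →₀ ℕ} (hm : m ∈ (rename lab (pm E)).support) :
    #(univ.map ι)ᶜ ≤ Finsupp.weight wt m := by
  rw [rename_pm] at hm
  obtain ⟨f, -, hf⟩ := Finset.mem_biUnion.mp (support_sum hm)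
  rw [isWeightedHomogeneous_term f (mem_support_iff.mp hf)]
  exact card_le_weight hwt hlab f

/-! #### Terms of weight exactly `K` come from dimer covers of the rhombus -/

/-- EQUALITY CASE: a fixed-point-free involution `f` whose term has weight exactly `K` is the
extension `ext d` of a dimer cover `d` of `R_n` (weight `0` on `range ι` forces `f (ι v) = ι (d v)`
with `v ∼ d v`; weight `1` off `range ι` forces `f = g` there). [folklore] -/
theorem exists_dimer_of_weight_eq (hwt : wt = Sum.elim (fun _ => 0) fun b => cond b 1 2)
    (hlab : (∀ v w, AdjR v w → lab (ι v, ι w) = Sum.inl (v, w)) ∧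
      (∀ p vw, lab p = Sum.inl vw → p = (ι vw.1, ι vw.2) ∧ AdjR vw.1 vw.2) ∧
      (∀ u, u ∉ Set.range ι → lab (u, g u) = Sum.inr true) ∧
      (∀ u u', u ∉ Set.range ι → lab (u, u') = Sum.inr true → u' = g u))
    (hext : (∀ d v, ext d (ι v) = ι (d v)) ∧ (∀ d u, u ∉ Set.range ι → ext d u = g u))
    (f : Fin k → Fin k) (hf : ∀ u, f (f u) = u ∧ f u ≠ u)
    (hK : ∑ u, wt (lab (u, f u)) = #(univ.map ι)ᶜ) :
    ∃ d : Fin n × Fin n → Fin n × Fin n, (∀ v, d (d v) = v ∧ d v ≠ v ∧ AdjR v (d v)) ∧ ext d = f := by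
  have hsplit := Finset.sum_add_sum_compl (univ.map ι) (fun u => wt (lab (u, f u)))
  have hge : ∀ u ∈ (univ.map ι)ᶜ, 1 ≤ wt (lab (u, f u)) := fun u hu =>
    one_le_wt_lab hwt hlab u (f u) hu
  have hge' : #(univ.map ι)ᶜ ≤ ∑ u ∈ (univ.map ι)ᶜ, wt (lab (u, f u)) :=
    calc #(univ.map ι)ᶜ = ∑ _u ∈ (univ.map ι)ᶜ, 1 := by rw [sum_const, smul_eq_mul, mul_one]
      _ ≤ _ := sum_le_sum hge
  have hS0 : ∑ u ∈ univ.map ι, wt (lab (u, f u)) = 0 := by omega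
  have hS1 : ∑ _u ∈ (univ.map ι)ᶜ, 1 = ∑ u ∈ (univ.map ι)ᶜ, wt (lab (u, f u)) := by
    rw [sum_const, smul_eq_mul, mul_one]; omega
  have h0 : ∀ v, wt (lab (ι v, f (ι v))) = 0 := fun v =>
    Finset.sum_eq_zero_iff.mp hS0 (ι v) (Finset.mem_map_of_mem ι (mem_univ v))
  have h1 : ∀ u ∈ (univ.map ι)ᶜ, wt (lab (u, f u)) = 1 := fun u hu =>
    ((Finset.sum_eq_sum_iff_of_le hge).mp hS1 u hu).symm
  have hgood : ∀ v, ∃ w, f (ι v) = ι w ∧ AdjR v w := fun v => by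
    obtain ⟨vw, hvw⟩ := wt_eq_zero hwt _ (h0 v)
    obtain ⟨hp, hadj⟩ := hlab.2.1 _ _ hvw
    rw [Prod.mk.injEq] at hp
    obtain rfl := ι.injective hp.1
    exact ⟨vw.2, hp.2, hadj⟩
  choose d hd using hgood
  refine ⟨d, fun v => ⟨?_, ?_, (hd v).2⟩, ?_⟩
  · apply ι.injective
    rw [← (hd (d v)).1, ← (hd v).1]
    exact (hf (ι v)).1
  · intro h
    apply (hf (ι v)).2
    rw [(hd v).1, h]
  · funext u
    by_cases hu : u ∈ Set.range ι
    · obtain ⟨v, rfl⟩ := hu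
      rw [hext.1]
      exact (hd v).1.symm
    · rw [hext.2 d u hu]
      exact (hlab.2.2.2 u (f u) hu (wt_eq_one hwt _ (h1 u (mem_compl_map.mpr hu)))).symm

/-- The extension of a dimer cover is a fixed-point-free involution along `E`. [folklore] -/
theorem ext_valid (hext : (∀ d v, ext d (ι v) = ι (d v)) ∧ (∀ d u, u ∉ Set.range ι → ext d u = g u))
    (hE : ∀ v w, AdjR v w → E (ι v) (ι w) = true)
    (hg : ∀ u, u ∉ Set.range ι → g (g u) = u ∧ g u ≠ u ∧ g u ∉ Set.range ι ∧ E u (g u) = true)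
    (d : Fin n × Fin n → Fin n × Fin n) (hd : ∀ v, d (d v) = v ∧ d v ≠ v ∧ AdjR v (d v))
    (u : Fin k) : ext d (ext d u) = u ∧ ext d u ≠ u ∧ E u (ext d u) = true := by
  by_cases hu : u ∈ Set.range ι
  · obtain ⟨v, rfl⟩ := hu
    rw [hext.1, hext.1, (hd v).1]
    exact ⟨rfl, fun h => (hd v).2.1 (ι.injective h), hE _ _ (hd v).2.2⟩
  · obtain ⟨h1, h2, h3, h4⟩ := hg u hu
    rw [hext.2 d u hu, hext.2 d (g u) h3, h1]
    exact ⟨rfl, h2, h4⟩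

/-- The term of the extension of a dimer cover `d`: `ε₁ ^ K` times the rhombus monomial of `d`.
[folklore] -/
theorem term_ext
    (hlab : (∀ v w, AdjR v w → lab (ι v, ι w) = Sum.inl (v, w)) ∧
      (∀ p vw, lab p = Sum.inl vw → p = (ι vw.1, ι vw.2) ∧ AdjR vw.1 vw.2) ∧
      (∀ u, u ∉ Set.range ι → lab (u, g u) = Sum.inr true) ∧
      (∀ u u', u ∉ Set.range ι → lab (u, u') = Sum.inr true → u' = g u))
    (hext : (∀ d v, ext d (ι v) = ι (d v)) ∧ (∀ d u, u ∉ Set.range ι → ext d u = g u))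
    (d : Fin n × Fin n → Fin n × Fin n) (hd : ∀ v, d (d v) = v ∧ d v ≠ v ∧ AdjR v (d v)) :
    ∏ u, (X (lab (u, ext d u)) : MvPolynomial ((Fin n × Fin n) × (Fin n × Fin n) ⊕ Bool) ℝ≥0) =
      X (Sum.inr true) ^ #(univ.map ι)ᶜ * rename Sum.inl (∏ v, X (v, d v)) := by
  rw [← Finset.prod_mul_prod_compl (univ.map ι), Finset.prod_map, mul_comm]
  congr 1
  · rw [← prod_const]
    refine prod_congr rfl fun u hu => ?_
    rw [mem_compl_map] at hu
    rw [hext.2 d u hu, hlab.2.2.1 u hu]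
  · rw [map_prod]
    refine prod_congr rfl fun v _ => ?_
    rw [rename_X, hext.1, hlab.1 _ _ (hd v).2.2]

/-- The term of the extension of a dimer cover has weight exactly `K`. [folklore] -/
theorem weight_ext (hwt : wt = Sum.elim (fun _ => 0) fun b => cond b 1 2)
    (hlab : (∀ v w, AdjR v w → lab (ι v, ι w) = Sum.inl (v, w)) ∧
      (∀ p vw, lab p = Sum.inl vw → p = (ι vw.1, ι vw.2) ∧ AdjR vw.1 vw.2) ∧
      (∀ u, u ∉ Set.range ι → lab (u, g u) = Sum.inr true) ∧
      (∀ u u', u ∉ Set.range ι → lab (u, u') = Sum.inr true → u' = g u))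
    (hext : (∀ d v, ext d (ι v) = ι (d v)) ∧ (∀ d u, u ∉ Set.range ι → ext d u = g u))
    (d : Fin n × Fin n → Fin n × Fin n) (hd : ∀ v, d (d v) = v ∧ d v ≠ v ∧ AdjR v (d v)) :
    ∑ u, wt (lab (u, ext d u)) = #(univ.map ι)ᶜ := by
  rw [← Finset.sum_add_sum_compl (univ.map ι), Finset.sum_map]
  have h0 : ∑ v, wt (lab (ι v, ext d (ι v))) = 0 :=
    Finset.sum_eq_zero fun v _ => by rw [hext.1, hlab.1 _ _ (hd v).2.2, hwt]; rfl
  have h1 : ∑ u ∈ (univ.map ι)ᶜ, wt (lab (u, ext d u)) = #(univ.map ι)ᶜ := by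
    rw [Finset.card_eq_sum_ones]
    refine sum_congr rfl fun u hu => ?_
    rw [mem_compl_map] at hu
    rw [hext.2 d u hu, hlab.2.2.1 u hu, hwt]; rfl
  rw [h0, h1, zero_add]

/-- The extension map is injective. [folklore] -/
theorem ext_injective
    (hext : (∀ d v, ext d (ι v) = ι (d v)) ∧ (∀ d u, u ∉ Set.range ι → ext d u = g u)) :
    Function.Injective ext := fun d₁ d₂ h => funext fun v =>
  ι.injective (by rw [← hext.1 d₁ v, ← hext.1 d₂ v, h])

end Core

/-- KEY LEMMA of the rhombus extraction: the lowest ε-component (weight `K = #(range ι)ᶜ`) of the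
relabelled matching polynomial of the supergraph is `ε₁ ^ K` times the rhombus dimer polynomial
`D_n` (in the variables `Sum.inl (v, w)`). [folklore] -/
theorem rhombusExtraction_key {n k : ℕ} {ι : Fin n × Fin n ↪ Fin k} {E : Fin k → Fin k → Bool}
    {g : Fin k → Fin k} {wt : (Fin n × Fin n) × (Fin n × Fin n) ⊕ Bool → ℕ}
    {lab : Fin k × Fin k → (Fin n × Fin n) × (Fin n × Fin n) ⊕ Bool}
    {ext : (Fin n × Fin n → Fin n × Fin n) → Fin k → Fin k}
    (hwt : wt = Sum.elim (fun _ => 0) fun b => cond b 1 2)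
    (hlab : (∀ v w, AdjR v w → lab (ι v, ι w) = Sum.inl (v, w)) ∧
      (∀ p vw, lab p = Sum.inl vw → p = (ι vw.1, ι vw.2) ∧ AdjR vw.1 vw.2) ∧
      (∀ u, u ∉ Set.range ι → lab (u, g u) = Sum.inr true) ∧
      (∀ u u', u ∉ Set.range ι → lab (u, u') = Sum.inr true → u' = g u))
    (hext : (∀ d v, ext d (ι v) = ι (d v)) ∧ (∀ d u, u ∉ Set.range ι → ext d u = g u))
    (hE : ∀ v w, AdjR v w → E (ι v) (ι w) = true)
    (hg : ∀ u, u ∉ Set.range ι → g (g u) = u ∧ g u ≠ u ∧ g u ∉ Set.range ι ∧ E u (g u) = true) :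
    weightedHomogeneousComponent wt #(univ.map ι)ᶜ (rename lab (pm E)) =
      X (Sum.inr true) ^ #(univ.map ι)ᶜ *
        rename Sum.inl (∑ d ∈ univ.filter (fun d : Fin n × Fin n → Fin n × Fin n =>
            ∀ v, d (d v) = v ∧ d v ≠ v ∧ AdjR v (d v)),
          ∏ v, (X (v, d v) : MvPolynomial ((Fin n × Fin n) × (Fin n × Fin n)) ℝ≥0)) := by
  rw [whc_rename_pm, map_sum, Finset.mul_sum]
  symm
  refine Finset.sum_nbij ext (fun d hd => ?_) (ext_injective hext).injOn (fun f hf => ?_)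
    (fun d hd => ?_)
  · rw [mem_filter] at hd
    rw [mem_filter, mem_filter]
    exact ⟨⟨mem_univ _, ext_valid hext hE hg d hd.2⟩, weight_ext hwt hlab hext d hd.2⟩
  · obtain ⟨hf1, hf2⟩ := mem_filter.mp (Finset.mem_coe.mp hf)
    obtain ⟨-, hf1⟩ := mem_filter.mp hf1
    obtain ⟨d, hd, rfl⟩ := exists_dimer_of_weight_eq hwt hlab hext _
      (fun u => ⟨(hf1 u).1, (hf1 u).2.1⟩) hf2
    exact ⟨d, Finset.mem_coe.mpr (mem_filter.mpr ⟨mem_univ _, hd⟩), rfl⟩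
  · rw [mem_filter] at hd
    exact (term_ext hlab hext d hd.2).symm

end Extraction

end

end Summit.ValiantsHypothesis.ValiantsHypothesis.Theorems.TriangularDimersDivisionEasy.Shuffling
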